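import Mathlib
import Summits.PneNP.PneNP.Theorems.ConvexRankGatesLinAlgGateBlindDefs

/-!
# Stub `stub_denseRegime` of line `dnf-invariant-wide-gates-see-small-cliques` for crux `LinAlgGateBlind`
(stmt-PneNP-10681, route ConvexRankGates): parameter asymptotics (auxiliary file)

Elementary real asymptotics of the parameters of the dense regime at `δ = 1/8`
(`kOf m = ⌈m^{1/8}⌉₊`, `lOf m = ⌊√(k/(4 log₂ m + 1))⌋₊`, `rOf c m = (l + c + 2)(⌊log₂ m⌋ + 1) + 2`,
`qOf m = 1 - 4 ln m / k`, `epsOf c m = m^{-(c+1)}/4`, see `ConvexRankGatesLinAlgGateBlindDefs`), organised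
around the scale `x = m^{1/16}` (so `m = x^16`, `m^{1/8} = x^2`). The one analytic input is
`log m = o(m^{1/16})` (`isLittleO_log_rpow_atTop`), packaged as "eventually `16 log m ≤ m^{1/16}`"; everything
else is monotonicity bookkeeping. Proved here (namespace `….DnfInvariantWideGatesSeeSmallCliques.DenseRegime`):
`x² ≤ k ≤ x² + 1`, `k ≤ m`, `l → ∞` (`tendsto_lOf`), `l ≤ x + 1`, `l + 1 ≤ k`, `r ≤ x²`, `0 ≤ q ≤ 1`,
`q^{C(l,2)} ≥ 1/2` (Bernoulli, `one_add_mul_le_pow`), `ε = 1/(4 m^{c+1})`, `m^c ε ≤ 1/16`, the plucking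
budget `4 (m+1)^l m^{c+1} ≤ 2^r` in `ℕ`, and the registered conjunction `denseRegime_params` (for every `c`,
eventually `m ≥ 4`, `16 log m ≤ x`, `c + 3 ≤ x`, `2c + 8 ≤ l`) consumed by
`ConvexRankGatesLinAlgGateBlindDenseRegime.lean`, which proves the registered stub `stub_denseRegime`.
No definitions; nothing is asserted without proof. [folklore]
-/

-- `Summit.PneNP.PneNP.…` duplicates `PneNP` BY DESIGN (single-problem summit).
set_option linter.dupNamespace false

noncomputable section

namespace Summit.PneNP.PneNP.Cruxes.LinAlgGateBlind.DnfInvariantWideGatesSeeSmallCliques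

open scoped BigOperators
open Finset Filter Literature.Computability.Complexity Razborov

namespace DenseRegime


/-! ### The scale `x = m^{1/16}` -/

/-- `1 ≤ m^{1/16}` for `m ≥ 1`. [folklore] -/
theorem one_le_rpow_sixteenth {m : ℕ} (hm : 1 ≤ m) : (1 : ℝ) ≤ (m : ℝ) ^ (1 / 16 : ℝ) :=
  Real.one_le_rpow (by exact_mod_cast hm) (by norm_num)

/-- `(m^{1/16})^2 = m^{1/8}`. [folklore] -/
theorem rpow_sixteenth_sq (m : ℕ) : ((m : ℝ) ^ (1 / 16 : ℝ)) ^ 2 = (m : ℝ) ^ (1 / 8 : ℝ) := by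
  rw [← Real.rpow_natCast, ← Real.rpow_mul (Nat.cast_nonneg m)]
  norm_num

/-- `(m^{1/16})^16 = m`. [folklore] -/
theorem rpow_sixteenth_pow (m : ℕ) : ((m : ℝ) ^ (1 / 16 : ℝ)) ^ 16 = (m : ℝ) := by
  rw [← Real.rpow_natCast, ← Real.rpow_mul (Nat.cast_nonneg m)]
  norm_num

/-- `m^{1/16} → ∞`. [folklore] -/
theorem tendsto_rpow_sixteenth : Tendsto (fun m : ℕ => (m : ℝ) ^ (1 / 16 : ℝ)) atTop atTop :=
  (tendsto_rpow_atTop (by norm_num)).comp tendsto_natCast_atTop_atTop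

/-- The analytic input: eventually `16 log m ≤ m^{1/16}` (`log = o(x^{1/16})`). [folklore] -/
theorem eventually_log_le_rpow_sixteenth :
    ∀ᶠ m : ℕ in atTop, 16 * Real.log m ≤ (m : ℝ) ^ (1 / 16 : ℝ) := by
  have h := ((isLittleO_log_rpow_atTop (by norm_num : (0 : ℝ) < 1 / 16)).comp_tendsto
    tendsto_natCast_atTop_atTop).def (by norm_num : (0 : ℝ) < 1 / 16)
  filter_upwards [h] with m hm
  have h1 : ‖Real.log m‖ = Real.log m := Real.norm_of_nonneg (Real.log_natCast_nonneg m)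
  have h2 : ‖(m : ℝ) ^ (1 / 16 : ℝ)‖ = (m : ℝ) ^ (1 / 16 : ℝ) :=
    Real.norm_of_nonneg (Real.rpow_nonneg (Nat.cast_nonneg m) _)
  simp only [Function.comp_def] at hm
  rw [h1, h2] at hm
  linarith


/-! ### `k = ⌈m^{1/8}⌉₊` -/

/-- `x² = m^{1/8} ≤ k`. [folklore] -/
theorem sq_le_kOf (m : ℕ) : ((m : ℝ) ^ (1 / 16 : ℝ)) ^ 2 ≤ (kOf m : ℝ) := by
  rw [rpow_sixteenth_sq]; exact Nat.le_ceil _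

/-- `k ≤ m^{1/8} + 1 = x² + 1`. [folklore] -/
theorem kOf_le_sq_add_one (m : ℕ) : (kOf m : ℝ) ≤ ((m : ℝ) ^ (1 / 16 : ℝ)) ^ 2 + 1 := by
  rw [rpow_sixteenth_sq]
  exact (Nat.ceil_lt_add_one (Real.rpow_nonneg (Nat.cast_nonneg m) _)).le

/-- `k ≤ 2x²` for `m ≥ 1`. [folklore] -/
theorem kOf_le_two_mul_sq {m : ℕ} (hm : 1 ≤ m) : (kOf m : ℝ) ≤ 2 * ((m : ℝ) ^ (1 / 16 : ℝ)) ^ 2 := by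
  have h1 := kOf_le_sq_add_one m
  have h2 := one_le_rpow_sixteenth hm
  nlinarith

/-- `1 ≤ k` for `m ≥ 1` (as reals). [folklore] -/
theorem one_le_kOf {m : ℕ} (hm : 1 ≤ m) : (1 : ℝ) ≤ (kOf m : ℝ) := by
  have h1 := sq_le_kOf m
  have h2 := one_le_rpow_sixteenth hm
  nlinarith

/-- `0 < k` for `m ≥ 1` (as reals). [folklore] -/
theorem kOf_pos {m : ℕ} (hm : 1 ≤ m) : (0 : ℝ) < (kOf m : ℝ) := by
  have := one_le_kOf hm; linarith

/-- `k ≤ m`. [folklore] -/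
theorem kOf_le_self (m : ℕ) : kOf m ≤ m := by
  unfold kOf
  refine Nat.ceil_le.2 ?_
  rcases Nat.eq_zero_or_pos m with rfl | hm
  · simp
  · calc (m : ℝ) ^ (1 / 8 : ℝ) ≤ (m : ℝ) ^ (1 : ℝ) :=
          Real.rpow_le_rpow_of_exponent_le (by exact_mod_cast hm) (by norm_num)
      _ = m := Real.rpow_one _

/-! ### Logarithms -/

/-- `0 ≤ log₂ m`. [folklore] -/
theorem logb_two_nonneg (m : ℕ) : 0 ≤ Real.logb 2 m := by
  rcases Nat.eq_zero_or_pos m with rfl | hm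
  · simp
  · exact Real.logb_nonneg one_lt_two (by exact_mod_cast hm)

/-- `1 ≤ 4 log₂ m + 1` (the denominator of the radicand of `l`). [folklore] -/
theorem one_le_denom (m : ℕ) : (1 : ℝ) ≤ 4 * Real.logb 2 m + 1 := by
  have := logb_two_nonneg m; linarith

/-- `0 < 4 log₂ m + 1`. [folklore] -/
theorem denom_pos (m : ℕ) : (0 : ℝ) < 4 * Real.logb 2 m + 1 := by
  have := logb_two_nonneg m; linarith

/-- `log₂ m ≤ 2 log m` (`log 2 > 1/2`). [folklore] -/
theorem logb_two_le_two_mul_log (m : ℕ) : Real.logb 2 m ≤ 2 * Real.log m := by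
  rw [Real.logb, div_le_iff₀ (Real.log_pos one_lt_two)]
  have h1 := Real.log_two_gt_d9
  have h2 := Real.log_natCast_nonneg m
  nlinarith

/-- `log m ≤ log₂ m` (`log 2 ≤ 1`). [folklore] -/
theorem log_le_logb_two (m : ℕ) : Real.log m ≤ Real.logb 2 m := by
  rw [Real.logb, le_div_iff₀ (Real.log_pos one_lt_two)]
  have h1 := Real.log_two_lt_d9
  have h2 := Real.log_natCast_nonneg m
  nlinarith

/-- `⌊log₂ m⌋ ≤ 2 log m` for `Nat.log 2 m`. [folklore] -/
theorem natLog_two_le_two_mul_log (m : ℕ) : (Nat.log 2 m : ℝ) ≤ 2 * Real.log m := by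
  rcases Nat.eq_zero_or_pos m with rfl | hm
  · simp
  · have h : 2 ^ Nat.log 2 m ≤ m := Nat.pow_log_le_self 2 hm.ne'
    have h' : (2 : ℝ) ^ Nat.log 2 m ≤ m := by exact_mod_cast h
    have hlog := Real.log_le_log (by positivity) h'
    rw [Real.log_pow] at hlog
    have h1 := Real.log_two_gt_d9
    have h2 := Real.log_natCast_nonneg m
    nlinarith

/-- `1 ≤ log m` for `m ≥ 3 > e`. [folklore] -/
theorem one_le_log {m : ℕ} (hm : 3 ≤ m) : (1 : ℝ) ≤ Real.log m := by
  rw [Real.le_log_iff_exp_le (by positivity)]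
  have h1 := Real.exp_one_lt_d9
  have h3 : (3 : ℝ) ≤ m := by exact_mod_cast hm
  linarith

/-! ### `l = ⌊√(k/(4 log₂ m + 1))⌋₊` -/

/-- The radicand `k/(4 log₂ m + 1)` is nonnegative. [folklore] -/
theorem radicand_nonneg (m : ℕ) : (0 : ℝ) ≤ (kOf m : ℝ) / (4 * Real.logb 2 m + 1) :=
  div_nonneg (Nat.cast_nonneg _) (denom_pos m).le

/-- `l² ≤ k/(4 log₂ m + 1)`. [folklore] -/
theorem lOf_sq_le (m : ℕ) : (lOf m : ℝ) ^ 2 ≤ (kOf m : ℝ) / (4 * Real.logb 2 m + 1) := by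
  have h := Nat.floor_le (Real.sqrt_nonneg ((kOf m : ℝ) / (4 * Real.logb 2 m + 1)))
  unfold lOf
  calc (⌊Real.sqrt ((kOf m : ℝ) / (4 * Real.logb 2 m + 1))⌋₊ : ℝ) ^ 2
      ≤ (Real.sqrt ((kOf m : ℝ) / (4 * Real.logb 2 m + 1))) ^ 2 :=
        pow_le_pow_left₀ (Nat.cast_nonneg _) h 2
    _ = _ := Real.sq_sqrt (radicand_nonneg m)

/-- `l² ≤ k`. [folklore] -/
theorem lOf_sq_le_kOf (m : ℕ) : (lOf m : ℝ) ^ 2 ≤ (kOf m : ℝ) :=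
  (lOf_sq_le m).trans (div_le_self (Nat.cast_nonneg _) (one_le_denom m))

/-- `l ≤ x + 1`. [folklore] -/
theorem lOf_le_rpow_add_one (m : ℕ) : (lOf m : ℝ) ≤ (m : ℝ) ^ (1 / 16 : ℝ) + 1 := by
  have h1 := lOf_sq_le_kOf m
  have h2 := kOf_le_sq_add_one m
  have hx : (0 : ℝ) ≤ (m : ℝ) ^ (1 / 16 : ℝ) := Real.rpow_nonneg (Nat.cast_nonneg m) _
  have h3 : (lOf m : ℝ) ^ 2 ≤ ((m : ℝ) ^ (1 / 16 : ℝ) + 1) ^ 2 := by nlinarith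
  exact (pow_le_pow_iff_left₀ (Nat.cast_nonneg _) (by positivity) two_ne_zero).1 h3

/-- `l + 1 ≤ k` once `x ≥ 2`. [folklore] -/
theorem lOf_add_one_le_kOf {m : ℕ} (hx : (2 : ℝ) ≤ (m : ℝ) ^ (1 / 16 : ℝ)) : lOf m + 1 ≤ kOf m := by
  have h1 := lOf_le_rpow_add_one m
  have h2 := sq_le_kOf m
  have h : ((lOf m + 1 : ℕ) : ℝ) ≤ (kOf m : ℝ) := by push_cast; nlinarith
  exact_mod_cast h

/-- `l → ∞`. [folklore] -/
theorem tendsto_lOf : Tendsto lOf atTop atTop := by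
  refine tendsto_atTop.2 fun b => ?_
  filter_upwards [eventually_log_le_rpow_sixteenth, eventually_ge_atTop 3,
    tendsto_rpow_sixteenth.eventually_ge_atTop ((b : ℝ) ^ 2)] with m hL hm3 hb
  have hL1 := one_le_log hm3
  have hD : 4 * Real.logb 2 m + 1 ≤ (m : ℝ) ^ (1 / 16 : ℝ) := by
    have := logb_two_le_two_mul_log m; linarith
  have hDpos := denom_pos m
  have hk := sq_le_kOf m
  have hb0 : (0 : ℝ) ≤ (b : ℝ) ^ 2 := sq_nonneg _
  have hR : (b : ℝ) ^ 2 ≤ (kOf m : ℝ) / (4 * Real.logb 2 m + 1) := by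
    rw [le_div_iff₀ hDpos]
    calc (b : ℝ) ^ 2 * (4 * Real.logb 2 m + 1)
        ≤ (m : ℝ) ^ (1 / 16 : ℝ) * (m : ℝ) ^ (1 / 16 : ℝ) := mul_le_mul hb hD hDpos.le (hb0.trans hb)
      _ = ((m : ℝ) ^ (1 / 16 : ℝ)) ^ 2 := (sq _).symm
      _ ≤ kOf m := hk
  unfold lOf
  exact Nat.le_floor (Real.le_sqrt_of_sq_le hR)

/-- `2 ≤ r`. [folklore] -/
theorem two_le_rOf (c m : ℕ) : 2 ≤ rOf c m := by
  unfold rOf; exact Nat.le_add_left 2 _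

/-- `r ≤ x²` in the good regime (`m ≥ 3`, `16 log m ≤ x`, `c + 3 ≤ x`). [folklore] -/
theorem rOf_le_sq {c m : ℕ} (hm : 3 ≤ m) (hL : 16 * Real.log m ≤ (m : ℝ) ^ (1 / 16 : ℝ))
    (hc : (c : ℝ) + 3 ≤ (m : ℝ) ^ (1 / 16 : ℝ)) :
    (rOf c m : ℝ) ≤ ((m : ℝ) ^ (1 / 16 : ℝ)) ^ 2 := by
  have hL1 := one_le_log hm
  have hl := lOf_le_rpow_add_one m
  have hlog := natLog_two_le_two_mul_log m
  have hx0 : (0 : ℝ) ≤ (m : ℝ) ^ (1 / 16 : ℝ) := Real.rpow_nonneg (Nat.cast_nonneg m) _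
  have hA : (lOf m : ℝ) + c + 2 ≤ 2 * (m : ℝ) ^ (1 / 16 : ℝ) := by linarith
  have hB : (Nat.log 2 m : ℝ) + 1 ≤ 3 * Real.log m := by linarith
  have hB0 : (0 : ℝ) ≤ (Nat.log 2 m : ℝ) + 1 := by positivity
  unfold rOf
  push_cast
  calc ((lOf m : ℝ) + c + 2) * ((Nat.log 2 m : ℝ) + 1) + 2
      ≤ (2 * (m : ℝ) ^ (1 / 16 : ℝ)) * (3 * Real.log m) + 2 := by
        have := mul_le_mul hA hB hB0 (by positivity); linarith
    _ ≤ ((m : ℝ) ^ (1 / 16 : ℝ)) ^ 2 := by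
        have h6 : (m : ℝ) ^ (1 / 16 : ℝ) * Real.log m ≤ (m : ℝ) ^ (1 / 16 : ℝ) * ((m : ℝ) ^ (1 / 16 : ℝ) / 16) :=
          mul_le_mul_of_nonneg_left (by linarith) hx0
        nlinarith

/-! ### `q = 1 - 4 log m / k` -/

/-- `4 log m ≤ k` in the good regime. [folklore] -/
theorem four_mul_log_le_kOf {m : ℕ} (hm : 1 ≤ m) (hL : 16 * Real.log m ≤ (m : ℝ) ^ (1 / 16 : ℝ)) :
    4 * Real.log m ≤ (kOf m : ℝ) := by
  have h1 := sq_le_kOf m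
  have h2 := one_le_rpow_sixteenth hm
  have h3 := Real.log_natCast_nonneg m
  nlinarith

/-- `0 ≤ q` once `4 log m ≤ k`. [folklore] -/
theorem qOf_nonneg {m : ℕ} (hm : 1 ≤ m) (hLk : 4 * Real.log m ≤ (kOf m : ℝ)) : 0 ≤ qOf m := by
  unfold qOf
  rw [sub_nonneg, div_le_one (kOf_pos hm)]
  exact hLk

/-- `q ≤ 1`. [folklore] -/
theorem qOf_le_one (m : ℕ) : qOf m ≤ 1 := by
  unfold qOf
  have : 0 ≤ 4 * Real.log m / (kOf m : ℝ) :=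
    div_nonneg (by linarith [Real.log_natCast_nonneg m]) (Nat.cast_nonneg _)
  linarith

/-- **Bernoulli step.** `q^{C(l,2)} ≥ 1 - C(l,2)·4 log m/k ≥ 1 - 2 log m/(4 log₂ m + 1) ≥ 1/2`. [folklore] -/
theorem half_le_qOf_pow {m : ℕ} (hm : 1 ≤ m) (hLk : 4 * Real.log m ≤ (kOf m : ℝ)) :
    (1 / 2 : ℝ) ≤ qOf m ^ ((lOf m).choose 2) := by
  have hk := kOf_pos hm
  have hD := denom_pos m
  have hL := Real.log_natCast_nonneg m
  have ht1 : 4 * Real.log m / (kOf m : ℝ) ≤ 1 := (div_le_one hk).2 hLk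
  have ht0 : 0 ≤ 4 * Real.log m / (kOf m : ℝ) := div_nonneg (by linarith) hk.le
  have hB := one_add_mul_le_pow (a := -(4 * Real.log m / (kOf m : ℝ))) (by linarith) ((lOf m).choose 2)
  have hq : qOf m = 1 + -(4 * Real.log m / (kOf m : ℝ)) := by unfold qOf; ring
  rw [hq]
  refine le_trans ?_ hB
  have hN : (((lOf m).choose 2 : ℕ) : ℝ) ≤ (lOf m : ℝ) ^ 2 / 2 := by
    rw [Nat.cast_choose_two]; nlinarith [(Nat.cast_nonneg (lOf m) : (0 : ℝ) ≤ lOf m)]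
  have hl2 := lOf_sq_le m
  have hlogb := log_le_logb_two m
  have h1 : (((lOf m).choose 2 : ℕ) : ℝ) * (4 * Real.log m / (kOf m : ℝ)) ≤
      ((kOf m : ℝ) / (4 * Real.logb 2 m + 1)) / 2 * (4 * Real.log m / (kOf m : ℝ)) := by
    apply mul_le_mul_of_nonneg_right _ ht0
    linarith
  have h2 : ((kOf m : ℝ) / (4 * Real.logb 2 m + 1)) / 2 * (4 * Real.log m / (kOf m : ℝ)) =
      2 * Real.log m / (4 * Real.logb 2 m + 1) := by
    field_simp
    ring
  have h3 : 2 * Real.log m / (4 * Real.logb 2 m + 1) ≤ 1 / 2 := by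
    rw [div_le_iff₀ hD]; linarith
  rw [h2] at h1
  linarith

/-! ### `ε = m^{-(c+1)}/4` -/

/-- `ε = 1/(4 m^{c+1})` with a natural-number power. [folklore] -/
theorem epsOf_eq (c m : ℕ) : epsOf c m = 1 / (4 * (m : ℝ) ^ (c + 1)) := by
  unfold epsOf
  rw [Real.rpow_neg (Nat.cast_nonneg m), show ((c : ℝ) + 1) = ((c + 1 : ℕ) : ℝ) by push_cast; ring,
    Real.rpow_natCast, inv_eq_one_div, div_div, mul_comm]

/-- `m^c · ε = 1/(4m) ≤ 1/16` for `m ≥ 4`. [folklore] -/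
theorem pow_mul_epsOf_le {c m : ℕ} (hm : 4 ≤ m) : ((m ^ c : ℕ) : ℝ) * epsOf c m ≤ 1 / 16 := by
  rw [epsOf_eq]
  have hm' : (4 : ℝ) ≤ m := by exact_mod_cast hm
  have hpos : (0 : ℝ) < m := by linarith
  have h : ((m ^ c : ℕ) : ℝ) * (1 / (4 * (m : ℝ) ^ (c + 1))) = 1 / (4 * m) := by
    push_cast
    field_simp
    ring
  rw [h, div_le_div_iff₀ (by positivity) (by norm_num)]
  linarith

/-- The plucking budget in `ℕ`: `4 (m+1)^l m^{c+1} ≤ 2^r` (`m + 1 ≤ 2^{⌊log₂ m⌋ + 1}`). [folklore] -/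
theorem four_mul_pow_le_two_pow_rOf (c m : ℕ) :
    4 * (m + 1) ^ lOf m * m ^ (c + 1) ≤ 2 ^ rOf c m := by
  have h : m + 1 ≤ 2 ^ (Nat.log 2 m + 1) := Nat.lt_pow_succ_log_self one_lt_two m
  have h1 : m ^ (c + 1) ≤ (m + 1) ^ (c + 2) :=
    (Nat.pow_le_pow_left (Nat.le_succ m) _).trans (Nat.pow_le_pow_right (Nat.succ_pos m) (Nat.le_succ _))
  calc 4 * (m + 1) ^ lOf m * m ^ (c + 1)
      ≤ 4 * (m + 1) ^ lOf m * (m + 1) ^ (c + 2) := Nat.mul_le_mul_left _ h1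
    _ = 4 * (m + 1) ^ (lOf m + c + 2) := by rw [mul_assoc, ← pow_add, add_assoc]
    _ ≤ 4 * (2 ^ (Nat.log 2 m + 1)) ^ (lOf m + c + 2) :=
        Nat.mul_le_mul_left _ (Nat.pow_le_pow_left h _)
    _ = 2 ^ rOf c m := by
        unfold rOf
        rw [← pow_mul, pow_add, mul_comm (4 : ℕ), mul_comm (Nat.log 2 m + 1)]
        norm_num

end DenseRegime

/-! ### The good regime, eventually -/

open DenseRegime in
/-- **Parameter regime (registered auxiliary statement).** For every `c`, eventually in `m`: `m ≥ 4`,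
`16 log m ≤ m^{1/16}`, `c + 3 ≤ m^{1/16}` and `2c + 8 ≤ l`. [folklore] -/
theorem denseRegime_params : ∀ c : ℕ, ∀ᶠ m : ℕ in atTop, 4 ≤ m ∧ 16 * Real.log m ≤ (m : ℝ) ^ (1 / 16 : ℝ) ∧ (c : ℝ) + 3 ≤ (m : ℝ) ^ (1 / 16 : ℝ) ∧ 2 * c + 8 ≤ lOf m := by
  intro c
  filter_upwards [eventually_ge_atTop 4, eventually_log_le_rpow_sixteenth,
    tendsto_rpow_sixteenth.eventually_ge_atTop ((c : ℝ) + 3),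
    tendsto_lOf.eventually_ge_atTop (2 * c + 8)] with m h1 h2 h3 h4
  exact ⟨h1, h2, h3, h4⟩

end Summit.PneNP.PneNP.Cruxes.LinAlgGateBlind.DnfInvariantWideGatesSeeSmallCliques

end
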